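import Summits.AtomisticToContinuum.HydrodynamicLimit.Theorems.RelayRaceLocalityNearConstantShortTimeHLSt2SplitDefs
import HarnessLib

/-!
# Crux `NearConstantShortTimeHL` (stmt-AtomisticToContinuum-12502), line `small-tilt-domination` — the NET REDUCTION of the
# mesoscale density large deviation to a log-Laplace bound for ball-average statistics (typed statement + the net lemma; lead c7)

Reviewed Defs file of the line (skeleton v14). The statics residue of the line is the registered stub
`stub_mesoscaleDensityLD : MesoscaleDensityLD` (`…St2SplitDefs`): an exponential-moment bound, at scale `n`, for the capped
quadratic MESOSCALE density deviation `F(x) = ∫ (1 + ρ̃) min 1 (ρ̃ − ρ₁)² dy` (`ρ̃(y) = n⁻¹ Σᵢ ballKernel ℓ y xᵢ`, `ℓ = n^{-1/4}`)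
under the matched canonical configurational Gibbs measure of the dilute hard-sphere gas. Skeleton v14 splits it:

  `MesoscaleDensityLD ⇐ BallTiltLogLaplaceBound`  (registered stub `stub_densityLD_of_ballTilt`, PROVABLE: the net reduction below)
  `BallTiltLogLaplaceBound`                          (registered stub `stub_ballTiltLogLaplace`, the analytic core: crux-sized statics).

THE NET REDUCTION (blueprint of `stub_densityLD_of_ballTilt`; every step elementary):
1. weight: on the hard-sphere support `ρ̃ ≤ 32/σ³` (`pd_ballAvg_le`), so `F ≤ (1 + 32/σ³) F₀`, `F₀ = ∫ min 1 (ρ̃ − ρ₁)² dy`;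
2. cells + Jensen: with the `k³` cells of `𝕋³` of mesh `1/k` (`torus_cells_partition`), `1/k ≤ ℓ/10`,
   `exp(c ∫ f) = exp(Σ_j c k⁻³ ⨍_{cell j} f) ≤ ⨍_{Π cells} exp(c k⁻³ Σ_j f(y_j)) d(y_j)_j` (Jensen for each normalised cell measure,
   product over cells): the `y`-integral becomes an average over SELECTIONS `y_j ∈ cell j` of a finite sum of point evaluations;
3. net: `min 1 d² ≤ λ_j d − λ_j²/4 + 1/(4m²)` for some `λ_j` of the net `{j/m − 2 : 0 ≤ j ≤ 4m}` (`min_one_sq_le_net` below), so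
   `exp(c k⁻³ Σ_j min 1 d(y_j)²) ≤ e^{c/(4m²)} Σ_{λ ∈ net^{cells}} exp(c k⁻³ Σ_j (λ_j d(y_j) − λ_j²/4))` (`(4m+1)^{k³} = e^{o(n)}` terms);
4. for each selection and each `λ` the exponent is LINEAR in the configuration: `c k⁻³ Σ_j λ_j ρ̃(y_j) = (c/n) Σᵢ G(xᵢ)` with the
   ball-average tilt `G = Σ_j k⁻³ λ_j ballKernel ℓ (y_j) ·`, `sup |G| ≤ 2 (1 + √3/(kℓ))³ ≤ 4` (cells meeting a ball of radius `ℓ` lie in the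
   ball of radius `ℓ + √3/k`: `volume_cell`, disjointness, `volume_setOf_euclidDist_lt_T3`), and `∫ G² ≤ 2 Σ_j k⁻³ λ_j²` (Schur);
5. Tonelli, `BallTiltLogLaplaceBound` at tilt strength `4γ`, `∫ G ρ₁ = Σ_j k⁻³ λ_j ρ₁(y_j) + O(Mℓ)` (Lipschitz profile,
   `integral_ballKernel_eq_one`), and the choice `γ ≤ min(γ₁/4, 1/(16 C₀))` make every term `≤ exp(n(κ/3 + κ/3))`; the count of the net and
   `c/(4m²) ≤ κ n/3` finish: `E exp(γ n F) ≤ exp(κ n)` eventually, uniformly over the boxed Lipschitz profiles.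

`BallTiltLogLaplaceBound` is the standard large-deviation upper bound for LINEAR statistics `Σᵢ G(xᵢ)` of the canonical inhomogeneous
dilute hard-sphere gas, with the correct centring `n ∫ G ρ₁` (local density approximation: the matched activity `ρ₁ e^{g_σ(ρ₁)}` has
cluster-series density exactly `ρ₁`, `thermoActivity_spec`) and a quadratic remainder `C₀ γ² n ∫ G²` sensitive to the `L²`-size of the
tilt (ideal-gas variance `n ∫ G² ρ₁` corrected by `O(η₁)` from the integrated truncated pair correlation `≲ ρ₁² ε³`), uniformly over
tilts in the ball-average class at scale `ℓ_n` and over the profile class, eventually in `N`. The tree's Kotecký–Preiss layer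
(`OneSphereInfluenceStaticScoreResponse…`: `exists_analytic_logPartition`, `variance_bound`) gives the sup-norm version (`C n γ²`
instead of `C₀ γ² n ∫G²`), which is too weak for sparse tilts; the `L²` version needs the decay of the truncated two-point function of the
canonical gas (Kirkwood–Salsburg / two-cluster files) — not assembled in the tree. References: H.-T. Yau, Lett. Math. Phys. 22 (1991)
§2; C. Kipnis – C. Landim (1999) App. 2 §3; E. Pulvirenti – D. Tsagkarogiannis, Comm. Math. Phys. 316 (2012) Thm 2.1; D. Ruelle,
Statistical Mechanics (1969) §4.2.
-/

noncomputable section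

namespace Summit.AtomisticToContinuum.HydrodynamicLimit.Theorems.NearConstantShortTimeHL

open scoped BigOperators ENNReal
open MeasureTheory Set Filter Topology
open Literature.MathematicalPhysics.KineticTheory Literature.Analysis.FluidPDE Literature.Analysis.FunctionSpaces

/-- **LOG-LAPLACE BOUND FOR BALL-AVERAGE TILTS under the matched canonical dilute hard-sphere Gibbs measure** (the analytic core of
`MesoscaleDensityLD`; conjecture-grade statics). There is a packing threshold `η₁ > 0` such that for every box size `M ≥ 1`, every
`σ > 0` and every admissible family `(ε_N > 0, ε_N → 0, n_N ε_N³ → σ³)` there are `C₀ > 0` and `γ₁ > 0` with: for every tilt strength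
`0 < γ ≤ γ₁` and every `κ > 0`, EVENTUALLY IN `N`, simultaneously for all continuous unit-mass `M`-Lipschitz profiles `ρ₁` with
`M⁻¹ ≤ ρ₁ ≤ η₁/σ³` and ALL finite signed combinations `G = Σ_j w_j · ballKernel ℓ_{n_N} (y_j) ·` of ball kernels with `sup |G| ≤ 1`:
`∫ exp(γ Σᵢ G(xᵢ)) d posGibbs(ρ₁ e^{g_σ(ρ₁)}, ε_N, n_N) ≤ exp(n_N [γ ∫ G ρ₁ + C₀ γ² ∫ G² + κ])`.
(`posGibbsMeasure` is the zero measure or a probability measure; for the zero measure the bound is trivial.)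
[cite: Yau1991, §2] [cite: PulvirentiTsagkarogiannis2012, Thm 2.1] -/
@[conjecture] def BallTiltLogLaplaceBound : Prop :=
  ∃ η₁ : ℝ, 0 < η₁ ∧ ∀ M : ℝ, 1 ≤ M → ∀ σ : ℝ, 0 < σ →
    let g : ℝ → ℝ := fun r => hsExcessFreeEnergy (r * σ ^ 3) + r * σ ^ 3 * deriv hsExcessFreeEnergy (r * σ ^ 3);
    ∀ (ε : ℕ → ℝ) (n : ℕ → ℕ), (∀ N, 0 < ε N) → Tendsto ε atTop (nhds 0) →
    Tendsto (fun N => (n N : ℝ) * ε N ^ 3) atTop (nhds (σ ^ 3)) →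
    ∃ C₀ : ℝ, 0 < C₀ ∧ ∃ γ₁ : ℝ, 0 < γ₁ ∧ ∀ γ : ℝ, 0 < γ → γ ≤ γ₁ → ∀ κ : ℝ, 0 < κ → ∀ᶠ N : ℕ in atTop,
    ∀ ρ₁ : T3 → ℝ, Continuous ρ₁ → (∫ x, ρ₁ x) = 1 → (∀ x, M⁻¹ ≤ ρ₁ x ∧ ρ₁ x * σ ^ 3 ≤ η₁) →
    (∀ x y, |ρ₁ x - ρ₁ y| ≤ M * dist x y) →
    ∀ (J : ℕ) (y : Fin J → T3) (w : Fin J → ℝ),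
    (∀ x : T3, |∑ j, w j * ballKernel (mesoRadius (n N)) (y j) x| ≤ 1) →
    ∫⁻ x, ENNReal.ofReal (Real.exp (γ * ∑ i, ∑ j, w j * ballKernel (mesoRadius (n N)) (y j) (x i)))
        ∂posGibbsMeasure (fun x => ρ₁ x * Real.exp (g (ρ₁ x))) (ε N) (n N) ≤
      ENNReal.ofReal (Real.exp ((n N : ℝ) *
        (γ * ∫ x, (∑ j, w j * ballKernel (mesoRadius (n N)) (y j) x) * ρ₁ x +
          C₀ * γ ^ 2 * ∫ x, (∑ j, w j * ballKernel (mesoRadius (n N)) (y j) x) ^ 2 + κ)))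

/-! ## The net lemma (step 3 of the reduction) -/

/-- **The quadratic net.** For every resolution `m ≥ 1` and every real `d`, some point `λ = j/m − 2` of the net
`{−2, −2 + 1/m, …, 2}` achieves `min 1 d² ≤ λ d − λ²/4 + 1/(4m²)`: for `|d| ≤ 1` take `λ` within `1/m` below `2d`
(`λ d − λ²/4 = d² − (λ − 2d)²/4`), for `d > 1` the same choice has `λ ≥ 2 − 1/m ≥ 1` and `λ d − λ²/4 ≥ λ − λ²/4 = 1 − (λ−2)²/4`,
for `d < −1` take `λ = −2`. [folklore] -/
theorem min_one_sq_le_net : ∀ {m : ℕ}, 0 < m → ∀ d : ℝ, ∃ j : Fin (4 * m + 1), min 1 (d ^ 2) ≤ ((j : ℝ) / m - 2) * d - ((j : ℝ) / m - 2) ^ 2 / 4 + 1 / (4 * (m : ℝ) ^ 2) := by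
  intro m hm d
  have hm0 : (0 : ℝ) < m := Nat.cast_pos.2 hm
  have hm1 : (1 : ℝ) ≤ m := by exact_mod_cast hm
  -- the clamped deviation `d' ∈ [-1, 1]` and the net index `j = ⌊m (2 d' + 2)⌋₊ ≤ 4m`
  set d' : ℝ := max (-1) (min 1 d) with hd'
  have hd'1 : d' ≤ 1 := max_le (by norm_num) (min_le_left _ _)
  have hd'0 : -1 ≤ d' := le_max_left _ _
  set t : ℝ := (m : ℝ) * (2 * d' + 2) with ht
  have ht0 : 0 ≤ t := mul_nonneg hm0.le (by linarith)
  have ht4 : t ≤ 4 * m := by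
    have : 2 * d' + 2 ≤ 4 := by linarith
    calc (m : ℝ) * (2 * d' + 2) ≤ (m : ℝ) * 4 := mul_le_mul_of_nonneg_left this hm0.le
      _ = 4 * m := by ring
  set jz : ℕ := ⌊t⌋₊ with hjz
  have hjz_le : (jz : ℝ) ≤ t := Nat.floor_le ht0
  have hjz_lt : t < (jz : ℝ) + 1 := Nat.lt_floor_add_one t
  have hjz4 : jz ≤ 4 * m := by
    have h : (jz : ℝ) ≤ (4 * m : ℕ) := by push_cast; exact hjz_le.trans ht4
    exact_mod_cast h
  refine ⟨⟨jz, by omega⟩, ?_⟩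
  -- the net point `λ = jz/m - 2` lies in `(2 d' - 1/m, 2 d']`
  set lam : ℝ := (jz : ℝ) / m - 2 with hlam
  have hlam_le : lam ≤ 2 * d' := by
    have h1 : (jz : ℝ) / m ≤ 2 * d' + 2 := by
      rw [div_le_iff₀ hm0]; calc (jz : ℝ) ≤ t := hjz_le
        _ = (2 * d' + 2) * m := by rw [ht]; ring
    simp only [hlam]; linarith
  have hlam_gt : 2 * d' - 1 / m < lam := by
    have h1 : 2 * d' + 2 - 1 / m < (jz : ℝ) / m := by
      rw [lt_div_iff₀ hm0]
      have : (2 * d' + 2 - 1 / m) * m = t - 1 := by rw [ht]; field_simp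
      rw [this]; linarith
    simp only [hlam]; linarith
  have hdev : (lam - 2 * d') ^ 2 ≤ (1 / m) ^ 2 := by
    have h1 : |lam - 2 * d'| ≤ 1 / m := abs_le.2 ⟨by linarith, by linarith⟩
    calc (lam - 2 * d') ^ 2 = |lam - 2 * d'| ^ 2 := (sq_abs _).symm
      _ ≤ (1 / m) ^ 2 := pow_le_pow_left₀ (abs_nonneg _) h1 2
  have hm2 : (1 / (m : ℝ)) ^ 2 / 4 = 1 / (4 * (m : ℝ) ^ 2) := by field_simp
  show min 1 (d ^ 2) ≤ lam * d - lam ^ 2 / 4 + 1 / (4 * (m : ℝ) ^ 2)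
  have key : lam * d - lam ^ 2 / 4 = d ^ 2 - (lam - 2 * d) ^ 2 / 4 := by ring
  rcases le_or_gt d 1 with hd1 | hd1
  · rcases le_or_gt (-1) d with hd0 | hd0
    · -- `|d| ≤ 1`: `d' = d`
      have hdd : d' = d := by rw [hd', min_eq_right hd1, max_eq_right hd0]
      rw [hdd] at hdev
      calc min 1 (d ^ 2) ≤ d ^ 2 := min_le_right _ _
        _ ≤ d ^ 2 - (lam - 2 * d) ^ 2 / 4 + 1 / (4 * (m : ℝ) ^ 2) := by rw [← hm2]; linarith
        _ = lam * d - lam ^ 2 / 4 + 1 / (4 * (m : ℝ) ^ 2) := by rw [key]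
    · -- `d < -1`: `d' = -1`, `t = 0`, `λ = -2`
      have hdd : d' = -1 := by
        rw [hd', min_eq_right hd1, max_eq_left hd0.le]
      have ht0' : t = 0 := by rw [ht, hdd]; ring
      have hjz0 : jz = 0 := by rw [hjz, ht0']; simp
      have hl : lam = -2 := by simp [hlam, hjz0]
      rw [hl]
      calc min 1 (d ^ 2) ≤ 1 := min_le_left _ _
        _ ≤ -2 * d - (-2) ^ 2 / 4 + 1 / (4 * (m : ℝ) ^ 2) := by
          have : (0 : ℝ) ≤ 1 / (4 * (m : ℝ) ^ 2) := by positivity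
          nlinarith
  · -- `d > 1`: `d' = 1`, `λ ∈ (2 - 1/m, 2]`, `λ ≥ 1`
    have hdd : d' = 1 := by
      rw [hd', min_eq_left hd1.le, max_eq_right (by norm_num)]
    rw [hdd] at hlam_le hlam_gt hdev
    have hlam1 : 1 ≤ lam := by
      have : 1 / (m : ℝ) ≤ 1 := by rw [div_le_one hm0]; exact hm1
      linarith
    have hlam0 : 0 ≤ lam := by linarith
    calc min 1 (d ^ 2) ≤ 1 := min_le_left _ _
      _ ≤ lam * 1 - lam ^ 2 / 4 + 1 / (4 * (m : ℝ) ^ 2) := by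
          have e : lam * 1 - lam ^ 2 / 4 = 1 - (lam - 2 * 1) ^ 2 / 4 := by ring
          rw [e, ← hm2]; linarith
      _ ≤ lam * d - lam ^ 2 / 4 + 1 / (4 * (m : ℝ) ^ 2) := by
          have : lam * 1 ≤ lam * d := mul_le_mul_of_nonneg_left hd1.le hlam0
          linarith

/-! ## The log-Laplace bound, correctly parenthesised (appended by lead c7)

`BallTiltLogLaplaceBound` above suffers the integral-binder precedence slip: its right-hand exponent
`γ * ∫ x, A x * ρ₁ x + C₀ * γ ^ 2 * ∫ x, B x ^ 2 + κ` parses as `γ * ∫ x, (A x * ρ₁ x + C₀ * γ ^ 2 * ∫ x', (B x' ^ 2 + κ))`,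
i.e. (over the Haar probability measure) `n (γ ∫Aρ₁ + C₀ γ³ ∫B² + C₀ γ³ κ)` — a quadratic remainder of order `γ³` for all
small `γ`, which the order-`γ²` variance of a linear statistic violates: that definition is NOT the intended statement and is
not used by the line (it should be read as misstated; it is kept only because landed files are append-only). The intended
statement, with every integral parenthesised and the smoothed tilt named by a `let`, is `BallTiltLogLaplace` below; the
registered stubs of skeleton v14 are `stub_ballTiltLogLaplace : BallTiltLogLaplace` and
`stub_densityLD_of_ballTilt : BallTiltLogLaplace → MesoscaleDensityLD`. -/

/-- **LOG-LAPLACE BOUND FOR BALL-AVERAGE TILTS under the matched canonical dilute hard-sphere Gibbs measure** (the analytic core of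
`MesoscaleDensityLD`; conjecture-grade statics; correctly parenthesised form of `BallTiltLogLaplaceBound`). There is a packing
threshold `η₁ > 0` such that for every box size `M ≥ 1`, every `σ > 0` and every admissible family `(ε_N > 0, ε_N → 0, n_N ε_N³ → σ³)`
there are `C₀ > 0` and `γ₁ > 0` with: for every tilt strength `0 < γ ≤ γ₁` and every `κ > 0`, EVENTUALLY IN `N`, simultaneously for all
continuous unit-mass `M`-Lipschitz profiles `ρ₁` with `M⁻¹ ≤ ρ₁ ≤ η₁/σ³` and ALL finite signed combinations
`G = Σ_j w_j · ballKernel ℓ_{n_N} (y_j) ·` of ball kernels with `sup |G| ≤ 1`: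
`∫ exp(γ Σᵢ G(xᵢ)) d posGibbs(ρ₁ e^{g_σ(ρ₁)}, ε_N, n_N) ≤ exp(n_N · (γ (∫ G ρ₁) + C₀ γ² (∫ G²) + κ))`.
Why true: `n⁻¹ log E e^{γ Σ G} = γ ∫ G ρ⁽¹⁾_N + (γ²/2) n⁻¹ Var_s(Σ G)` for some `s ∈ [0, γ]`; the one-point density `ρ⁽¹⁾_N → ρ₁`
uniformly over the class (local density approximation at the matched activity, `thermoActivity_spec`), and the variance of a linear
statistic of the dilute gas is `≤ n ρ_max e^{2γ} (1 + O(η₁)) ∫ G²` (ideal-gas term plus the integrated truncated pair correlation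
`≲ ρ₁² ε³`, canonical correction nonpositive). (`posGibbsMeasure` is the zero measure or a probability measure.)
[cite: Yau1991, §2] [cite: PulvirentiTsagkarogiannis2012, Thm 2.1] -/
@[conjecture] def BallTiltLogLaplace : Prop :=
  ∃ η₁ : ℝ, 0 < η₁ ∧ ∀ M : ℝ, 1 ≤ M → ∀ σ : ℝ, 0 < σ →
    let g : ℝ → ℝ := fun r => hsExcessFreeEnergy (r * σ ^ 3) + r * σ ^ 3 * deriv hsExcessFreeEnergy (r * σ ^ 3);
    ∀ (ε : ℕ → ℝ) (n : ℕ → ℕ), (∀ N, 0 < ε N) → Tendsto ε atTop (nhds 0) →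
    Tendsto (fun N => (n N : ℝ) * ε N ^ 3) atTop (nhds (σ ^ 3)) →
    ∃ C₀ : ℝ, 0 < C₀ ∧ ∃ γ₁ : ℝ, 0 < γ₁ ∧ ∀ γ : ℝ, 0 < γ → γ ≤ γ₁ → ∀ κ : ℝ, 0 < κ → ∀ᶠ N : ℕ in atTop,
    ∀ ρ₁ : T3 → ℝ, Continuous ρ₁ → (∫ x, ρ₁ x) = 1 → (∀ x, M⁻¹ ≤ ρ₁ x ∧ ρ₁ x * σ ^ 3 ≤ η₁) →
    (∀ x y, |ρ₁ x - ρ₁ y| ≤ M * dist x y) →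
    ∀ (J : ℕ) (y : Fin J → T3) (w : Fin J → ℝ),
    let G : T3 → ℝ := fun x => ∑ j, w j * ballKernel (mesoRadius (n N)) (y j) x;
    (∀ x : T3, |G x| ≤ 1) →
    ∫⁻ x, ENNReal.ofReal (Real.exp (γ * ∑ i, G (x i)))
        ∂posGibbsMeasure (fun x => ρ₁ x * Real.exp (g (ρ₁ x))) (ε N) (n N) ≤
      ENNReal.ofReal (Real.exp ((n N : ℝ) * (γ * (∫ x, G x * ρ₁ x) + C₀ * γ ^ 2 * (∫ x, G x ^ 2) + κ)))

/-- **Read-back of the parenthesisation** (sanity, registered): unfolding the `let`, the bound of `BallTiltLogLaplace` is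
literally the intended three-term exponent `n (γ (∫Gρ₁) + C₀ γ² (∫G²) + κ)`. [folklore] -/
theorem ballTiltLogLaplace_iff : BallTiltLogLaplace ↔
    ∃ η₁ : ℝ, 0 < η₁ ∧ ∀ M : ℝ, 1 ≤ M → ∀ σ : ℝ, 0 < σ →
    ∀ (ε : ℕ → ℝ) (n : ℕ → ℕ), (∀ N, 0 < ε N) → Tendsto ε atTop (nhds 0) →
    Tendsto (fun N => (n N : ℝ) * ε N ^ 3) atTop (nhds (σ ^ 3)) →
    ∃ C₀ : ℝ, 0 < C₀ ∧ ∃ γ₁ : ℝ, 0 < γ₁ ∧ ∀ γ : ℝ, 0 < γ → γ ≤ γ₁ → ∀ κ : ℝ, 0 < κ → ∀ᶠ N : ℕ in atTop,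
    ∀ ρ₁ : T3 → ℝ, Continuous ρ₁ → (∫ x, ρ₁ x) = 1 → (∀ x, M⁻¹ ≤ ρ₁ x ∧ ρ₁ x * σ ^ 3 ≤ η₁) →
    (∀ x y, |ρ₁ x - ρ₁ y| ≤ M * dist x y) →
    ∀ (J : ℕ) (y : Fin J → T3) (w : Fin J → ℝ),
    (∀ x : T3, |∑ j, w j * ballKernel (mesoRadius (n N)) (y j) x| ≤ 1) →
    ∫⁻ x, ENNReal.ofReal (Real.exp (γ * ∑ i, ∑ j, w j * ballKernel (mesoRadius (n N)) (y j) (x i)))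
        ∂posGibbsMeasure (fun x => ρ₁ x * Real.exp (hsExcessFreeEnergy (ρ₁ x * σ ^ 3) +
          ρ₁ x * σ ^ 3 * deriv hsExcessFreeEnergy (ρ₁ x * σ ^ 3))) (ε N) (n N) ≤
      ENNReal.ofReal (Real.exp ((n N : ℝ) *
        (γ * (∫ x, (∑ j, w j * ballKernel (mesoRadius (n N)) (y j) x) * ρ₁ x) +
          C₀ * γ ^ 2 * (∫ x, (∑ j, w j * ballKernel (mesoRadius (n N)) (y j) x) ^ 2) + κ))) :=
  Iff.rfl

end Summit.AtomisticToContinuum.HydrodynamicLimit.Theorems.NearConstantShortTimeHL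

end
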